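import Literature.MathematicalPhysics.QuantumFieldTheory.Balaban1983to89.Beta.KKTSplit
import Literature.MathematicalPhysics.QuantumFieldTheory.Balaban1983to89.Beta.Envelope
import Literature.MathematicalPhysics.QuantumFieldTheory.Balaban1983to89.Beta.LogDetHessian

/-!
# `Balaban1983to89.Beta.CompositionSingular` — BETA sub-cell, row an2 (b2b-balaban-beta-an2, background-field route):
the COMPOSITION LAW for constrained Gaussian normalisations WITHOUT an invertible fine form, and the BACKGROUND-FIELD
CALCULUS (fluctuation covariance · minimiser · effective form) read off the bordered inverse — kernel-checked
finite-dimensional linear algebra, `[folklore]` throughout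

HONEST FRAMING (cell file `HOME/BETA-SPEC.md`, verbatim): discharging `BetaPertH` makes Bałaban's UV stability
UNCONDITIONAL — a real constructive-QFT result; it is NOT the continuum limit and NOT the Clay problem.  THIS MODULE
DISCHARGES NOTHING of `FlowStep.BetaPertH` / (M2⁺) and asserts NOTHING about Bałaban's β-functions or his concrete lattice
operators `Δ(U)`, `Q(U)`, `R(U)D*_U`, `G`, `H`, `G₁`, `H₁`: it proves no bound and no `k`-uniformity.  Value = kernel
identity, NOT summit progress.  It supplies the structural half of the an2 items (D1-tel)/(N1) of `HOME/BETA/AN2.md` in the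
case BOTH landed composition modules name as missing: `Beta.Composition` (module docstring, GAUSSIAN MEANING: "if `H` is
only positive on `ker Q` … the effective block form is `−((kkt H Q)⁻¹)₂₂`, which is `P⁻¹` only for invertible `H` — all
theorems of this file carry `IsUnit H.det` explicitly") and `Beta.CompositionOneLoop` ("the singular-`Δ` case is not covered
here …; not attempted").  Massless lattice forms and gauge-field forms before gauge fixing are singular on the whole space
and non-degenerate only on the constraint surface; this file is written for exactly that situation.

CITATION HEADER (lean-in-tree rule 2026-08-18; every declaration below is tagged `[folklore]` — classical block-matrix
algebra; the two papers are cited for ORIENTATION of the dictionary only, quoted from the cell's page renders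
`HOME/b2b-balaban-ref1/pages/…` as transcribed in `HOME/BETA/OBJECTS.md` §2, §10):
* T. Bałaban, "Propagators for lattice gauge theories in a background field", *Comm. Math. Phys.* **99**, 389–434 (1985)
  [Balaban1985BackgroundPropagators] (cell paper B9), Sect. D.  p. 417, (3.109)–(3.112): «we define H(U)B, or simply HB,
  as a minimal configuration of the functional A → ½⟨A, Δ(U)A⟩ (3.109) on a set of configurations A … satisfying
  L^jηQ_j(U)A = B on Λ_j, j = 0,1,…,k, R(U)D*_U A = 0 (3.110) … the functional (3.109) is equal to
  A → ½⟨A,(Δ + DRD* + Q*aQ)A⟩ − ½⟨B,aB⟩ = ½⟨A,Δ_aA⟩ − ½⟨B,aB⟩ (3.111) on the hyperplane (3.110) …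
  HB = Z⁻¹(B) ∫ dA δ(QA − B) δ_R(RD*A) e^{−½⟨A,ΔA⟩} A (3.112) … This formula can be proved easily by making the
  translation A = A′ + HB and then noticing that the term with A′ vanishes»;  p. 420, (3.122)–(3.126): «G⁻¹ defined as
  G⁻¹ = Δ_π + DRD* + Q*aQ … h(A,ω) = ½⟨A,G⁻¹A⟩ − ⟨ω,QA − B⟩ … δh/δA = G⁻¹A − Q*ω = 0, δh/δω = QA − B = 0, hence
  A = GQ*ω, QGQ*ω = B, ω = (QGQ*)⁻¹B, and finally A = GQ*(QGQ*)⁻¹B … HB = GQ*(QGQ*)⁻¹B (3.126)»;  p. 421 (3.129)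
  «H₁B = G₁Q*(QG₁Q*)⁻¹B»;  p. 428 (3.155)–(3.158) (the one-step integral of RG I written with these operators; the
  quadratic form in the block variable printed as «⟨B,(QG₁Q*)⁻¹B⟩ − a⟨B,B⟩ …», (3.156)).
* T. Bałaban, "Renormalization group approach to lattice gauge field theories. I", *Comm. Math. Phys.* **109**, 249–301
  (1987) [Balaban1987RG1] (cell paper B12): (1.1)–(1.5) pp. 260–261 (k one-step transformations = one k-fold
  transformation; the one-loop factors `Z^{(j)}`); p. 268 L1–12 (elimination by the δ-functions; «⟨δA′,J⟩ = 0 for all δA′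
  satisfying Q̃Q_kδA′ = 0» — the first-order condition of the constrained minimiser, used there for the LINEAR term).

WHAT IS PROVED (all over an arbitrary `Field 𝕜` unless marked ℝ; `kkt H Q = [[H, Qᵀ],[Q, 0]]`, `compForm H Q G = H + QᵀGQ`,
`blockProp H Q = QH⁻¹Qᵀ`, `logZ`, `Chain`, `total`, `compQ` are those of `Beta.Composition`, consumed by name).
* §1 DEFINITIONS from the bordered inverse `W := (kkt H Q)⁻¹` ALONE (so `H` may be singular): `flucCov H Q := W₁₁`
  (fluctuation covariance 𝒢), `minOp H Q := W₁₂` (minimiser / background-field operator ℋ), `minOpL H Q := W₂₁` (ℋ♭),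
  `effForm H Q := −W₂₂` (effective form 𝒮).  Under the SINGLE hypothesis `IsUnit (kkt H Q).det`: the eight block identities
  (`kkt_mul_blocks`, `blocks_mul_kkt`: `Qℋ = 1`, `Q𝒢 = 0`, `𝒢Qᵀ = 0`, `ℋ♭Qᵀ = 1`, `H𝒢 + Qᵀℋ♭ = 1`, EULER–LAGRANGE `Hℋ = Qᵀ𝒮`,
  `ℋ♭H = 𝒮Q`); the VALUE IDENTITY `ℋᵀHℋ = 𝒮` (`transpose_minOp_mul_mul_minOp`, no symmetry needed); `H`-ORTHOGONALITY of
  fluctuations to background fields `ZᵀHℋ = 0` for `QZ = 0` (`transpose_mul_mul_minOp_eq_zero`); the BACKGROUND-FIELD SPLIT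
  of the action `(ℋY + Z)ᵀH(ℋY + Z) = Yᵀ𝒮Y + ZᵀHZ` for symmetric `H`, `QZ = 0` (`backgroundField_split` — the
  finite-dimensional content of «making the translation A = A′ + HB … the term with A′ vanishes», p. 417); symmetry
  (`minOpL_eq_transpose`).
* §2 THE TWO SCHUR FACTORISATIONS of the un-integrated four-block matrix `unint H Q₁ G Q₂ = [[kkt H Q₁, cpl],[cplᵀ, kkt G Q₂]]`
  (first multiplier coupled to the block field by `−1`) and of its regrouping `unint'` (middle block `[[0,−1],[−1,G]]`,
  unimodular: `det_mid`), giving the MAIN THEOREM `det_kkt_compForm_of_kkt`: if `kkt H Q₁` is invertible then for all `G`, `Q₂`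
  `det kkt(H + Q₁ᵀGQ₁, Q₂Q₁) = (−1)^{|μ|} · det kkt(H, Q₁) · det kkt(𝒮 + G, Q₂)`, `𝒮 = effForm H Q₁`,
  and the non-degeneracy transfer `det_kkt_compForm_ne_zero_iff` / `isUnit_det_kkt_compForm`.  Compare
  `Composition.det_kkt_compForm`: three invertibility hypotheses (`H`, `Q₁H⁻¹Q₁ᵀ`, the composite form), effective form
  `(Q₁H⁻¹Q₁ᵀ)⁻¹`.
* §3 CONSISTENCY (`blocks_eq_of_inv`, from `Envelope.kkt_inv` by name): for invertible `H` with invertible `P = QH⁻¹Qᵀ`,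
  `𝒮 = P⁻¹`, `ℋ = H⁻¹QᵀP⁻¹ = Envelope.minMap H Q` (the «GQ*(QGQ*)⁻¹» pattern of (3.126)), `ℋ♭ = Envelope.minMapL H Q`,
  `𝒢 = Envelope.constrProp H Q`; hence `det_kkt_compForm_of_inv` = `Composition.det_kkt_compForm` minus its third hypothesis.
* §4 THE `a`-SHIFT (`blocks_add_conj`, via `KKTSplit.kkt_add_conj_eq`): for EVERY square `A`,
  `𝒢, ℋ, ℋ♭ (H + QᵀAQ) Q = 𝒢, ℋ, ℋ♭ H Q` and `𝒮(H + QᵀAQ) Q = 𝒮 H Q + A`; hence (`blocks_eq_of_reg`, `effForm_eq_of_reg`) with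
  `K := H + QᵀAQ` and `P_K := QK⁻¹Qᵀ` invertible and `H` POSSIBLY SINGULAR: `IsUnit (kkt H Q).det` holds
  (`isUnit_kkt_det_of_reg`), `𝒮 = P_K⁻¹ − A`, `ℋ = K⁻¹QᵀP_K⁻¹`, `𝒢 = constrProp K Q`; and the composition law in these
  variables, `det_kkt_compForm_reg`: `det kkt(H + Q₁ᵀGQ₁, Q₂Q₁) = (−1)^{|μ|} det kkt(H,Q₁) · det kkt(P_K⁻¹ − A + G, Q₂)`.
* §5 THE FULL INVERSE of `unint` in both groupings (`unintInv_eq`, `unint'Inv_toBlocks₁₁`, `kktInv_compForm_apply`) and the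
  COMPOSITION OF THE THREE BLOCKS under `IsUnit (kkt H Q₁).det`, `IsUnit (kkt (𝒮₁ + G) Q₂).det` (`𝒮₁ := effForm H Q₁`):
  `effForm_compForm`:  `𝒮(H + Q₁ᵀGQ₁)(Q₂Q₁) = 𝒮(𝒮₁ + G) Q₂`;
  `minOp_compForm`:    `ℋ(H + Q₁ᵀGQ₁)(Q₂Q₁) = ℋ(H,Q₁) · ℋ(𝒮₁ + G, Q₂)`  (background fields compose);
  `minOpL_compForm`:   the transposed statement;
  `flucCov_compForm`:  `𝒢(H + Q₁ᵀGQ₁)(Q₂Q₁) = 𝒢(H,Q₁) + ℋ(H,Q₁) · 𝒢(𝒮₁ + G, Q₂) · ℋ♭(H,Q₁)`  (two-step telescoping).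
* §6 (ℝ) `logZ_compForm_of_kkt`: `logZ (H + Q₁ᵀGQ₁) (Q₂Q₁) = logZ H Q₁ + logZ (𝒮₁ + G) Q₂` under the two bordered
  non-vanishings only (compare `Composition.logZ_compForm`, four hypotheses).
* §7 THE k-FOLD ITERATE THROUGH BORDERED INVERSES for a `Composition.Chain`: `seff` (`seff 0 = H₀`,
  `seff (j+1) = effForm (seff j + G j) (Q j)`), `sstep j = seff j + G j`, composed minimisers `sminOp`, `sminOpL`; if every
  one-step bordered matrix `kkt (sstep j) (Q j)`, `j ≤ k`, is invertible then (`scomp_invariant`) the one-shot bordered matrix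
  `kkt (total (k+1)) (compQ (k+1))` is invertible with `effForm = seff (k+1)`, `minOp = sminOp (k+1)`, `minOpL = sminOpL (k+1)`;
  (`flucCov_total`) `flucCov (total (k+1)) (compQ (k+1)) = Σ_{j ≤ k} sminOp j · flucCov (sstep j) (Q j) · sminOpL j`;
  (ℝ, `logZ_total_of_kkt`) `logZ (total (k+1)) (compQ (k+1)) = Σ_{j ≤ k} logZ (sstep j) (Q j)` — `Composition.Chain.logZ_total`
  with the step forms allowed to be singular off the constraint surface.
* §8 (ℝ) KERNEL-BASIS DICTIONARY (`blocks_eq_kernelBasis`, from `LogDetHessian.kkt_inv_eq_blockInv` by name): for `QC = 0`,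
  `CᵀC`, `QQᵀ`, `CᵀΔC` nonsingular, `κ ≃ ν ⊕ τ`:  `flucCov Δ Q = LogDetHessian.cov Δ C = C(CᵀΔC)⁻¹Cᵀ`,
  `minOp = LogDetHessian.minimiser`, `minOpL = LogDetHessian.cominimiser`, `effForm = LogDetHessian.schur`, and these
  hypotheses give `IsUnit (kkt Δ Q).det` (`isUnit_kkt_det_of_kernelBasis`) — so §§2–7 apply verbatim to the objects of
  `Beta.LogDetHessian` Part 2b (whose `Δ` is only assumed non-degenerate on `ker Q = range C`).

DICTIONARY / READING (this seat's, recorded in the cell's DIVERGENCE.md as D-an2.20 — NOT a quotation, NOT a cited fact, NOT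
used by any theorem): with `H ↦` the fine quadratic form of one step restricted by the gauge δ-functions (B9 (3.109) with the
second condition of (3.110) adjoined to `Q`, as in the tree's `Beta.ConstrainedGaussian` dictionary of OBJECTS.md §10 O13),
`Q ↦` the stacked averaging-and-gauge constraint, `A ↦ a·1`:  `minOp` ↦ Bałaban's `H` of (3.112)/(3.126) (conditional mean =
minimiser), `effForm H Q = (QK⁻¹Qᵀ)⁻¹ − a` (§4) ↦ the first two terms «(QG₁Q*)⁻¹ − a» of the block quadratic form (3.156),
`flucCov` ↦ the fluctuation propagator of the translated integral (3.121)/(3.123), `backgroundField_split` ↦ «translation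
A = A′ + HB … the term with A′ vanishes» (p. 417) and B12 p. 268 «⟨δA′,J⟩ = 0 for all δA′ satisfying Q̃Q_kδA′ = 0»,
`minOp_compForm` ↦ "the k-fold minimiser is the composite of the one-step minimisers" (B9 p. 421: H of the k-fold problem
(3.109)–(3.110) vs. the one-step operators), `logZ_total_of_kkt` ↦ B12 (1.3)'s `Σ_j log Z^{(j)}`.  The J-term
«−2⟨HC^{(2)}(A),J⟩» of B9 (3.127)/(3.128) and B12 (1.5) is a CHANGE OF THE FINE FORM `H` (OBJECTS.md §10.1 (i)–(ii)); this
file is agnostic to it — every theorem holds for every `H` with an invertible bordered matrix.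

WHAT THIS FILE DOES NOT DO.  (i) It does not touch binder (D1) `hident` of
`ComposedRoad.oneLoopDrift_of_composedLegInterfacePow_identity_avg` (cell verdict BETA-SPEC v1.9zw §7.34: PRECISELY WALLED,
nothing of (M2⁺) discharged) — it re-expresses the composition/normalisation structure such an identity must respect, for
singular fine forms, and discharges none of it.  (ii) No norm, decay or `k`-uniform bound on `flucCov`, `minOp`, `effForm`
(B9 Theorems 3.3/3.10/3.11 are about Bałaban's concrete operators and are not formalised here).  (iii) No positivity:
over ℝ nothing here says `effForm` is positive definite when `H ≥ 0` on `ker Q` (true, classical; not needed for the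
identities and not proved).  (iv) No `def … : Prop` facts are minted (D-0026); nothing programme-internal is cited.
-/

noncomputable section

namespace Literature.MathematicalPhysics.QuantumFieldTheory.Balaban1983to89.Beta.CompositionSingular

open Literature.MathematicalPhysics.QuantumFieldTheory.Balaban1983to89.Beta.Composition
open Literature.MathematicalPhysics.QuantumFieldTheory.Balaban1983to89.Beta.KKTSplit (rowOp kkt_add_conj_eq det_kkt_add_conj)
open scoped Matrix BigOperators
open Matrix

section Field

variable {𝕜 : Type*} [Field 𝕜]
variable {ν μ κ : Type*} [Fintype ν] [Fintype μ] [Fintype κ] [DecidableEq ν] [DecidableEq μ] [DecidableEq κ]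

/-! ## §1. The three blocks of the bordered inverse: fluctuation covariance, minimiser, effective form -/

/-- The EFFECTIVE (block) FORM of the constrained datum `(H, Q)` read off the bordered inverse:
`effForm H Q := −((kkt H Q)⁻¹)₂₂`, the negative of the `μ × μ` corner of `[[H, Qᵀ],[Q, 0]]⁻¹`.  It needs only the bordered
matrix to be invertible (i.e. `Q` onto and `H` non-degenerate on `ker Q`), not `H`; for invertible `H` it is
`(Q H⁻¹ Qᵀ)⁻¹` (`effForm_eq_blockProp_inv`), in a kernel basis it is `LogDetHessian.schur` (`effForm_eq_schur`). [folklore] -/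
def effForm (H : Matrix ν ν 𝕜) (Q : Matrix μ ν 𝕜) : Matrix μ μ 𝕜 :=
  -((kkt H Q)⁻¹).toBlocks₂₂

/-- The MINIMISER OPERATOR read off the bordered inverse: `minOp H Q := ((kkt H Q)⁻¹)₁₂ : block field ↦ fine field`
(for invertible `H` it is `H⁻¹Qᵀ(QH⁻¹Qᵀ)⁻¹ = Envelope.minMap`, the pattern of [Balaban1985BackgroundPropagators] (3.126)
`H = GQ*(QGQ*)⁻¹`, `minOp_eq_minMap`; in a kernel basis `LogDetHessian.minimiser`, `minOp_eq_minimiser`). [folklore] -/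
def minOp (H : Matrix ν ν 𝕜) (Q : Matrix μ ν 𝕜) : Matrix ν μ 𝕜 :=
  ((kkt H Q)⁻¹).toBlocks₁₂

/-- The LEFT COMPANION of the minimiser operator: `minOpL H Q := ((kkt H Q)⁻¹)₂₁` (`= (minOp H Q)ᵀ` for symmetric `H`,
`minOpL_eq_transpose`; `Envelope.minMapL`, `LogDetHessian.cominimiser`). [folklore] -/
def minOpL (H : Matrix ν ν 𝕜) (Q : Matrix μ ν 𝕜) : Matrix μ ν 𝕜 :=
  ((kkt H Q)⁻¹).toBlocks₂₁

/-- The FLUCTUATION COVARIANCE read off the bordered inverse: `flucCov H Q := ((kkt H Q)⁻¹)₁₁` (for invertible `H` it is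
`H⁻¹ − H⁻¹Qᵀ(QH⁻¹Qᵀ)⁻¹QH⁻¹ = Envelope.constrProp`, `flucCov_eq_constrProp`; in a kernel basis `C(CᵀHC)⁻¹Cᵀ =
LogDetHessian.cov`, `flucCov_eq_cov`). [folklore] -/
def flucCov (H : Matrix ν ν 𝕜) (Q : Matrix μ ν 𝕜) : Matrix ν ν 𝕜 :=
  ((kkt H Q)⁻¹).toBlocks₁₁

omit [Fintype ν] [Fintype μ] [DecidableEq ν] [DecidableEq μ] in
/-- Block form of the bordered matrix. [folklore] -/
theorem kkt_eq_fromBlocks (H : Matrix ν ν 𝕜) (Q : Matrix μ ν 𝕜) : kkt H Q = fromBlocks H Qᵀ Q 0 := rfl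

/-- The bordered inverse in terms of the three named blocks. [folklore] -/
theorem kktInv_eq_fromBlocks (H : Matrix ν ν 𝕜) (Q : Matrix μ ν 𝕜) :
    (kkt H Q)⁻¹ = fromBlocks (flucCov H Q) (minOp H Q) (minOpL H Q) (-effForm H Q) := by
  unfold flucCov minOp minOpL effForm
  rw [neg_neg, fromBlocks_toBlocks]

/-- Right-inverse identities `kkt · kkt⁻¹ = 1`, block by block: `H·𝒢 + Qᵀ·ℋᴸ = 1`, `H·ℋ = Qᵀ·𝒮` (Euler–Lagrange),
`Q·𝒢 = 0`, `Q·ℋ = 1` (the minimiser satisfies the constraint). [folklore] -/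
theorem kkt_mul_blocks (H : Matrix ν ν 𝕜) (Q : Matrix μ ν 𝕜) (h : IsUnit (kkt H Q).det) :
    H * flucCov H Q + Qᵀ * minOpL H Q = 1 ∧ H * minOp H Q = Qᵀ * effForm H Q ∧ Q * flucCov H Q = 0 ∧
      Q * minOp H Q = 1 := by
  have hX : kkt H Q * (kkt H Q)⁻¹ = 1 := Matrix.mul_nonsing_inv _ h
  rw [kktInv_eq_fromBlocks, kkt_eq_fromBlocks, fromBlocks_multiply, ← fromBlocks_one, fromBlocks_inj] at hX
  obtain ⟨h11, h12, h21, h22⟩ := hX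
  rw [Matrix.zero_mul, add_zero] at h21 h22
  refine ⟨h11, ?_, h21, h22⟩
  rw [Matrix.mul_neg, add_neg_eq_zero] at h12
  exact h12

/-- Left-inverse identities `kkt⁻¹ · kkt = 1`, block by block: `𝒢·H + ℋ·Q = 1`, `𝒢·Qᵀ = 0`, `ℋᴸ·H = 𝒮·Q`, `ℋᴸ·Qᵀ = 1`.
[folklore] -/
theorem blocks_mul_kkt (H : Matrix ν ν 𝕜) (Q : Matrix μ ν 𝕜) (h : IsUnit (kkt H Q).det) :
    flucCov H Q * H + minOp H Q * Q = 1 ∧ flucCov H Q * Qᵀ = 0 ∧ minOpL H Q * H = effForm H Q * Q ∧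
      minOpL H Q * Qᵀ = 1 := by
  have hX : (kkt H Q)⁻¹ * kkt H Q = 1 := Matrix.nonsing_inv_mul _ h
  rw [kktInv_eq_fromBlocks, kkt_eq_fromBlocks, fromBlocks_multiply, ← fromBlocks_one, fromBlocks_inj] at hX
  obtain ⟨h11, h12, h21, h22⟩ := hX
  rw [Matrix.mul_zero, add_zero] at h12 h22
  refine ⟨h11, h12, ?_, h22⟩
  rw [Matrix.neg_mul, add_neg_eq_zero] at h21
  exact h21

/-- `Q · minOp H Q = 1`. [folklore] -/
theorem mul_minOp (H : Matrix ν ν 𝕜) (Q : Matrix μ ν 𝕜) (h : IsUnit (kkt H Q).det) : Q * minOp H Q = 1 :=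
  (kkt_mul_blocks H Q h).2.2.2

/-- `minOpL H Q · Qᵀ = 1`. [folklore] -/
theorem minOpL_mul_transpose (H : Matrix ν ν 𝕜) (Q : Matrix μ ν 𝕜) (h : IsUnit (kkt H Q).det) :
    minOpL H Q * Qᵀ = 1 :=
  (blocks_mul_kkt H Q h).2.2.2

/-- `Q · flucCov H Q = 0`. [folklore] -/
theorem mul_flucCov (H : Matrix ν ν 𝕜) (Q : Matrix μ ν 𝕜) (h : IsUnit (kkt H Q).det) : Q * flucCov H Q = 0 :=
  (kkt_mul_blocks H Q h).2.2.1

/-- `flucCov H Q · Qᵀ = 0`. [folklore] -/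
theorem flucCov_mul_transpose (H : Matrix ν ν 𝕜) (Q : Matrix μ ν 𝕜) (h : IsUnit (kkt H Q).det) :
    flucCov H Q * Qᵀ = 0 :=
  (blocks_mul_kkt H Q h).2.1

/-- EULER–LAGRANGE: `H · minOp H Q = Qᵀ · effForm H Q` — the multiplier of the constrained critical point `minOp H Q y`
is `effForm H Q y`. [folklore] -/
theorem mul_minOp_eq (H : Matrix ν ν 𝕜) (Q : Matrix μ ν 𝕜) (h : IsUnit (kkt H Q).det) :
    H * minOp H Q = Qᵀ * effForm H Q :=
  (kkt_mul_blocks H Q h).2.1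

/-- THE VALUE IDENTITY (the effective form IS the value of the fine form on the constrained critical point):
`(minOp H Q)ᵀ · H · minOp H Q = effForm H Q` — NO invertibility and NO symmetry of `H` (compare
`Envelope.transpose_minMap_mul_mul_minMap`, invertible symmetric `K`). [folklore] -/
theorem transpose_minOp_mul_mul_minOp (H : Matrix ν ν 𝕜) (Q : Matrix μ ν 𝕜) (h : IsUnit (kkt H Q).det) :
    (minOp H Q)ᵀ * H * minOp H Q = effForm H Q := by
  rw [Matrix.mul_assoc, mul_minOp_eq H Q h, ← Matrix.mul_assoc, ← Matrix.transpose_mul, mul_minOp H Q h,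
    Matrix.transpose_one, Matrix.one_mul]

/-- FLUCTUATIONS ARE `H`-ORTHOGONAL TO BACKGROUND FIELDS: if `Q Z = 0` then `Zᵀ · H · minOp H Q = 0` — the first-order
condition of the constrained critical point (the pattern of [Balaban1985BackgroundPropagators] (3.117)–(3.121):
expanding the action about the minimiser produces no linear term in the fluctuation). [folklore] -/
theorem transpose_mul_mul_minOp_eq_zero (H : Matrix ν ν 𝕜) (Q : Matrix μ ν 𝕜) (h : IsUnit (kkt H Q).det)
    {ρ : Type*} (Z : Matrix ν ρ 𝕜) (hZ : Q * Z = 0) : Zᵀ * H * minOp H Q = 0 := by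
  rw [Matrix.mul_assoc, mul_minOp_eq H Q h, ← Matrix.mul_assoc, ← Matrix.transpose_mul, hZ, Matrix.transpose_zero,
    Matrix.zero_mul]

/-- THE BACKGROUND-FIELD SPLIT OF THE ACTION: for symmetric `H`, a configuration "background field with prescribed
averages `Y` plus a fluctuation `Z` in `ker Q`", `minOp H Q · Y + Z` with `Q Z = 0`, has action
`(ℋY + Z)ᵀ H (ℋY + Z) = Yᵀ · effForm H Q · Y + Zᵀ H Z` — effective action of the averages plus the bare action of the
fluctuation, no cross term.  (`H` need not be invertible: massless / gauge-degenerate fine forms included, as long as the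
bordered matrix is.) [folklore] -/
theorem backgroundField_split (H : Matrix ν ν 𝕜) (Q : Matrix μ ν 𝕜) (hH : Hᵀ = H) (h : IsUnit (kkt H Q).det)
    {ρ : Type*} (Y : Matrix μ ρ 𝕜) (Z : Matrix ν ρ 𝕜) (hZ : Q * Z = 0) :
    (minOp H Q * Y + Z)ᵀ * H * (minOp H Q * Y + Z) = Yᵀ * effForm H Q * Y + Zᵀ * H * Z := by
  have h1 : ∀ W : Matrix μ ρ 𝕜, Zᵀ * (H * (minOp H Q * W)) = 0 := fun W => by
    rw [← Matrix.mul_assoc, ← Matrix.mul_assoc, transpose_mul_mul_minOp_eq_zero H Q h Z hZ, Matrix.zero_mul]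
  have h2 : (minOp H Q)ᵀ * (H * Z) = 0 := by
    have e := congrArg Matrix.transpose (transpose_mul_mul_minOp_eq_zero H Q h Z hZ)
    rwa [Matrix.transpose_mul, Matrix.transpose_mul, Matrix.transpose_transpose, hH, Matrix.transpose_zero] at e
  have hv : ∀ W : Matrix μ ρ 𝕜, (minOp H Q)ᵀ * (H * (minOp H Q * W)) = effForm H Q * W := fun W => by
    rw [← Matrix.mul_assoc, ← Matrix.mul_assoc, transpose_minOp_mul_mul_minOp H Q h]
  simp only [Matrix.transpose_add, Matrix.transpose_mul, Matrix.add_mul, Matrix.mul_add, Matrix.mul_assoc, h1, h2, hv,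
    Matrix.mul_zero, add_zero, zero_add]

/-- For SYMMETRIC `H` the bordered inverse is symmetric: `minOpL = minOpᵀ`, and `flucCov`, `effForm` are symmetric.
[folklore] -/
theorem minOpL_eq_transpose (H : Matrix ν ν 𝕜) (Q : Matrix μ ν 𝕜) (hH : Hᵀ = H) :
    minOpL H Q = (minOp H Q)ᵀ ∧ (flucCov H Q)ᵀ = flucCov H Q ∧ (effForm H Q)ᵀ = effForm H Q := by
  have hK : (kkt H Q)ᵀ = kkt H Q := by
    rw [kkt_eq_fromBlocks, fromBlocks_transpose, transpose_transpose, hH, transpose_zero]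
  have hW : ((kkt H Q)⁻¹)ᵀ = (kkt H Q)⁻¹ := by rw [transpose_nonsing_inv, hK]
  rw [kktInv_eq_fromBlocks, fromBlocks_transpose, fromBlocks_inj] at hW
  obtain ⟨h1, -, h3, h4⟩ := hW
  refine ⟨h3.symm, h1, ?_⟩
  rwa [transpose_neg, neg_inj] at h4

/-! ## §2. The un-integrated four-block matrix and its two Schur factorisations -/

variable (𝕜 ν μ κ) in
/-- The coupling block `[[0, 0],[−1, 0]]` : (fine field, first multiplier) × (block field, second multiplier) — the first
multiplier sees the block field with coefficient `−1`. [folklore] -/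
def cpl₁₂ : Matrix (ν ⊕ μ) (μ ⊕ κ) 𝕜 :=
  fromBlocks (0 : Matrix ν μ 𝕜) (0 : Matrix ν κ 𝕜) (-1 : Matrix μ μ 𝕜) (0 : Matrix μ κ 𝕜)

variable (𝕜 ν μ κ) in
/-- The transposed coupling block `[[0, −1],[0, 0]]`. [folklore] -/
def cpl₂₁ : Matrix (μ ⊕ κ) (ν ⊕ μ) 𝕜 :=
  fromBlocks (0 : Matrix μ ν 𝕜) (-1 : Matrix μ μ 𝕜) (0 : Matrix κ ν 𝕜) (0 : Matrix κ μ 𝕜)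

/-- The UN-INTEGRATED bordered matrix of the two-step datum, on `(ν ⊕ μ) ⊕ (μ ⊕ κ)` = (fine field, first multiplier)
⊕ (block field, second multiplier): `[[kkt H Q₁, cpl₁₂],[cpl₂₁, kkt G Q₂]]`, the first multiplier coupled to the block
field by `−1`.  (Gaussian meaning, orientation only: the quadratic form of `∫ dx dy δ(y − Q₁x) δ(Q₂y) e^{−½xHx − ½yGy}` with
both δ's written as Fourier integrals over the multipliers.) [folklore] -/
def unint (H : Matrix ν ν 𝕜) (Q₁ : Matrix μ ν 𝕜) (G : Matrix μ μ 𝕜) (Q₂ : Matrix κ μ 𝕜) :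
    Matrix ((ν ⊕ μ) ⊕ (μ ⊕ κ)) ((ν ⊕ μ) ⊕ (μ ⊕ κ)) 𝕜 :=
  fromBlocks (kkt H Q₁) (cpl₁₂ 𝕜 ν μ κ) (cpl₂₁ 𝕜 ν μ κ) (kkt G Q₂)

/-- The middle block `[[0, −1],[−1, G]]` (first multiplier, block field) of the regrouped matrix. [folklore] -/
def mid (G : Matrix μ μ 𝕜) : Matrix (μ ⊕ μ) (μ ⊕ μ) 𝕜 :=
  fromBlocks (0 : Matrix μ μ 𝕜) (-1 : Matrix μ μ 𝕜) (-1 : Matrix μ μ 𝕜) G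

/-- Its inverse `[[−G, −1],[−1, 0]]`. [folklore] -/
def midInv (G : Matrix μ μ 𝕜) : Matrix (μ ⊕ μ) (μ ⊕ μ) 𝕜 :=
  fromBlocks (-G) (-1 : Matrix μ μ 𝕜) (-1 : Matrix μ μ 𝕜) (0 : Matrix μ μ 𝕜)

/-- The outer block `[[H, 0],[0, 0]]` (fine field, second multiplier). [folklore] -/
def outer (H : Matrix ν ν 𝕜) (κ : Type*) : Matrix (ν ⊕ κ) (ν ⊕ κ) 𝕜 :=
  fromBlocks H (0 : Matrix ν κ 𝕜) (0 : Matrix κ ν 𝕜) (0 : Matrix κ κ 𝕜)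

/-- The outer-to-middle coupling `[[Q₁ᵀ, 0],[0, Q₂]]`. [folklore] -/
def om (Q₁ : Matrix μ ν 𝕜) (Q₂ : Matrix κ μ 𝕜) : Matrix (ν ⊕ κ) (μ ⊕ μ) 𝕜 :=
  fromBlocks Q₁ᵀ (0 : Matrix ν μ 𝕜) (0 : Matrix κ μ 𝕜) Q₂

/-- The middle-to-outer coupling `[[Q₁, 0],[0, Q₂ᵀ]]`. [folklore] -/
def mo (Q₁ : Matrix μ ν 𝕜) (Q₂ : Matrix κ μ 𝕜) : Matrix (μ ⊕ μ) (ν ⊕ κ) 𝕜 :=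
  fromBlocks Q₁ (0 : Matrix μ κ 𝕜) (0 : Matrix μ ν 𝕜) Q₂ᵀ

/-- The same matrix grouped as (fine field, second multiplier) ⊕ (first multiplier, block field), on
`(ν ⊕ κ) ⊕ (μ ⊕ μ)`. [folklore] -/
def unint' (H : Matrix ν ν 𝕜) (Q₁ : Matrix μ ν 𝕜) (G : Matrix μ μ 𝕜) (Q₂ : Matrix κ μ 𝕜) :
    Matrix ((ν ⊕ κ) ⊕ (μ ⊕ μ)) ((ν ⊕ κ) ⊕ (μ ⊕ μ)) 𝕜 :=
  fromBlocks (outer H κ) (om Q₁ Q₂) (mo Q₁ Q₂) (mid G)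

/-- The regrouping permutation `(ν ⊕ μ) ⊕ (μ ⊕ κ) ≃ (ν ⊕ κ) ⊕ (μ ⊕ μ)`. [folklore] -/
def regroup (ν μ κ : Type*) : (ν ⊕ μ) ⊕ (μ ⊕ κ) ≃ (ν ⊕ κ) ⊕ (μ ⊕ μ) where
  toFun
    | Sum.inl (Sum.inl x) => Sum.inl (Sum.inl x)
    | Sum.inl (Sum.inr l) => Sum.inr (Sum.inl l)
    | Sum.inr (Sum.inl y) => Sum.inr (Sum.inr y)
    | Sum.inr (Sum.inr l) => Sum.inl (Sum.inr l)
  invFun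
    | Sum.inl (Sum.inl x) => Sum.inl (Sum.inl x)
    | Sum.inl (Sum.inr l) => Sum.inr (Sum.inr l)
    | Sum.inr (Sum.inl l) => Sum.inl (Sum.inr l)
    | Sum.inr (Sum.inr y) => Sum.inr (Sum.inl y)
  left_inv := by rintro ((x | l) | (y | l)) <;> rfl
  right_inv := by rintro ((x | l) | (l | y)) <;> rfl

omit [Fintype ν] [Fintype μ] [Fintype κ] [DecidableEq ν] [DecidableEq κ] in
/-- The two groupings are the same matrix up to the permutation `regroup`. [folklore] -/
theorem unint_eq_submatrix (H : Matrix ν ν 𝕜) (Q₁ : Matrix μ ν 𝕜) (G : Matrix μ μ 𝕜) (Q₂ : Matrix κ μ 𝕜) :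
    unint H Q₁ G Q₂ = (unint' H Q₁ G Q₂).submatrix (regroup ν μ κ) (regroup ν μ κ) := by
  ext i j
  rcases i with ((x | l) | (y | l)) <;> rcases j with ((x' | l') | (y' | l')) <;> rfl

/-- Hence the inverses agree up to the same permutation (`Matrix.inv_submatrix_equiv`). [folklore] -/
theorem unintInv_eq_submatrix (H : Matrix ν ν 𝕜) (Q₁ : Matrix μ ν 𝕜) (G : Matrix μ μ 𝕜) (Q₂ : Matrix κ μ 𝕜) :
    (unint H Q₁ G Q₂)⁻¹ = ((unint' H Q₁ G Q₂)⁻¹).submatrix (regroup ν μ κ) (regroup ν μ κ) := by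
  rw [unint_eq_submatrix, Matrix.inv_submatrix_equiv]

/-- `mid G · midInv G = 1`. [folklore] -/
theorem mid_mul_midInv (G : Matrix μ μ 𝕜) : mid G * midInv G = 1 := by
  unfold mid midInv
  rw [fromBlocks_multiply, ← fromBlocks_one]
  simp

/-- `midInv G · mid G = 1`. [folklore] -/
theorem midInv_mul_mid (G : Matrix μ μ 𝕜) : midInv G * mid G = 1 := by
  unfold mid midInv
  rw [fromBlocks_multiply, ← fromBlocks_one]
  simp

/-- The middle block is invertible, with inverse `midInv G`. [folklore] -/
@[reducible] def midInvertible (G : Matrix μ μ 𝕜) : Invertible (mid G) := ⟨midInv G, midInv_mul_mid G, mid_mul_midInv G⟩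

omit [Fintype κ] [DecidableEq ν] [DecidableEq κ] in
/-- `X · cpl₁₂ = [[−X₁₂, 0],[−X₂₂, 0]]`. [folklore] -/
theorem mul_cpl₁₂ (X : Matrix (ν ⊕ μ) (ν ⊕ μ) 𝕜) :
    X * cpl₁₂ 𝕜 ν μ κ = fromBlocks (-X.toBlocks₁₂) 0 (-X.toBlocks₂₂) 0 := by
  conv_lhs => rw [← fromBlocks_toBlocks X]
  unfold cpl₁₂
  simp only [fromBlocks_multiply, Matrix.mul_zero, Matrix.mul_neg, Matrix.mul_one, zero_add, add_zero]

omit [Fintype κ] [DecidableEq ν] [DecidableEq κ] in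
/-- `cpl₂₁ · X = [[−X₂₁, −X₂₂],[0, 0]]`. [folklore] -/
theorem cpl₂₁_mul (X : Matrix (ν ⊕ μ) (ν ⊕ μ) 𝕜) :
    cpl₂₁ 𝕜 ν μ κ * X = fromBlocks (-X.toBlocks₂₁) (-X.toBlocks₂₂) 0 0 := by
  conv_lhs => rw [← fromBlocks_toBlocks X]
  unfold cpl₂₁
  simp only [fromBlocks_multiply, Matrix.zero_mul, Matrix.neg_mul, Matrix.one_mul, zero_add, add_zero]

omit [DecidableEq ν] [DecidableEq κ] in
/-- `−(X · cpl₁₂ · Y) = [[X₁₂Y₁₁, X₁₂Y₁₂],[X₂₂Y₁₁, X₂₂Y₁₂]]`. [folklore] -/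
theorem neg_mul_cpl₁₂_mul (X : Matrix (ν ⊕ μ) (ν ⊕ μ) 𝕜) (Y : Matrix (μ ⊕ κ) (μ ⊕ κ) 𝕜) :
    -(X * cpl₁₂ 𝕜 ν μ κ * Y) = fromBlocks (X.toBlocks₁₂ * Y.toBlocks₁₁) (X.toBlocks₁₂ * Y.toBlocks₁₂)
      (X.toBlocks₂₂ * Y.toBlocks₁₁) (X.toBlocks₂₂ * Y.toBlocks₁₂) := by
  rw [mul_cpl₁₂]
  conv_lhs => rw [← fromBlocks_toBlocks Y]
  simp only [fromBlocks_multiply, Matrix.zero_mul, Matrix.neg_mul, add_zero, fromBlocks_neg, neg_neg]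

omit [DecidableEq ν] [DecidableEq κ] in
/-- `−(Y · cpl₂₁ · X) = [[Y₁₁X₂₁, Y₁₁X₂₂],[Y₂₁X₂₁, Y₂₁X₂₂]]`. [folklore] -/
theorem neg_mul_cpl₂₁_mul (Y : Matrix (μ ⊕ κ) (μ ⊕ κ) 𝕜) (X : Matrix (ν ⊕ μ) (ν ⊕ μ) 𝕜) :
    -(Y * cpl₂₁ 𝕜 ν μ κ * X) = fromBlocks (Y.toBlocks₁₁ * X.toBlocks₂₁) (Y.toBlocks₁₁ * X.toBlocks₂₂)
      (Y.toBlocks₂₁ * X.toBlocks₂₁) (Y.toBlocks₂₁ * X.toBlocks₂₂) := by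
  rw [Matrix.mul_assoc, cpl₂₁_mul]
  conv_lhs => rw [← fromBlocks_toBlocks Y]
  simp only [fromBlocks_multiply, Matrix.mul_zero, Matrix.mul_neg, add_zero, fromBlocks_neg, neg_neg]

omit [DecidableEq ν] [DecidableEq κ] in
/-- `X · cpl₁₂ · Y · cpl₂₁ · X = [[X₁₂Y₁₁X₂₁, X₁₂Y₁₁X₂₂],[X₂₂Y₁₁X₂₁, X₂₂Y₁₁X₂₂]]`. [folklore] -/
theorem mul_cpl₁₂_mul_mul_cpl₂₁_mul (X : Matrix (ν ⊕ μ) (ν ⊕ μ) 𝕜) (Y : Matrix (μ ⊕ κ) (μ ⊕ κ) 𝕜) :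
    X * cpl₁₂ 𝕜 ν μ κ * Y * cpl₂₁ 𝕜 ν μ κ * X =
      fromBlocks (X.toBlocks₁₂ * Y.toBlocks₁₁ * X.toBlocks₂₁) (X.toBlocks₁₂ * Y.toBlocks₁₁ * X.toBlocks₂₂)
        (X.toBlocks₂₂ * Y.toBlocks₁₁ * X.toBlocks₂₁) (X.toBlocks₂₂ * Y.toBlocks₁₁ * X.toBlocks₂₂) := by
  rw [Matrix.mul_assoc (X * cpl₁₂ 𝕜 ν μ κ * Y), cpl₂₁_mul, ← neg_neg (X * cpl₁₂ 𝕜 ν μ κ * Y), neg_mul_cpl₁₂_mul,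
    Matrix.neg_mul]
  simp only [fromBlocks_multiply, Matrix.mul_neg, Matrix.mul_zero, add_zero, fromBlocks_neg, neg_neg]

omit [Fintype κ] [DecidableEq ν] [DecidableEq κ] in
/-- SCHUR COMPLEMENT OF THE FIRST GROUPING with respect to the (fine field, first multiplier) block, for ANY candidate
inverse block matrix `X`: `kkt G Q₂ − cpl₂₁ · X · cpl₁₂ = kkt (−X₂₂ + G) Q₂` — only the multiplier–multiplier corner of `X`
survives. [folklore] -/
theorem schur_unint (X : Matrix (ν ⊕ μ) (ν ⊕ μ) 𝕜) (G : Matrix μ μ 𝕜) (Q₂ : Matrix κ μ 𝕜) :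
    kkt G Q₂ - cpl₂₁ 𝕜 ν μ κ * X * cpl₁₂ 𝕜 ν μ κ = kkt (-X.toBlocks₂₂ + G) Q₂ := by
  rw [← fromBlocks_toBlocks X]
  unfold cpl₁₂ cpl₂₁ kkt
  simp only [fromBlocks_multiply, Matrix.zero_mul, Matrix.mul_zero, add_zero, zero_add, Matrix.neg_mul,
    Matrix.mul_neg, Matrix.one_mul, Matrix.mul_one, neg_neg, toBlocks_fromBlocks₂₂, sub_eq_add_neg, fromBlocks_neg,
    fromBlocks_add, neg_zero, add_comm G]

omit [Fintype ν] [Fintype κ] [DecidableEq ν] [DecidableEq κ] in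
/-- SCHUR COMPLEMENT OF THE SECOND GROUPING with respect to the (first multiplier, block field) block:
`outer H − om · midInv G · mo = kkt (H + Q₁ᵀ G Q₁) (Q₂ Q₁)` — the composite datum appears. [folklore] -/
theorem schur_unint' (H : Matrix ν ν 𝕜) (Q₁ : Matrix μ ν 𝕜) (G : Matrix μ μ 𝕜) (Q₂ : Matrix κ μ 𝕜) :
    outer H κ - om Q₁ Q₂ * midInv G * mo Q₁ Q₂ = kkt (compForm H Q₁ G) (Q₂ * Q₁) := by
  unfold outer om midInv mo kkt compForm
  simp only [fromBlocks_multiply, Matrix.zero_mul, Matrix.mul_zero, add_zero, zero_add, Matrix.neg_mul,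
    Matrix.mul_neg, Matrix.mul_one, neg_zero, Matrix.transpose_mul, Matrix.mul_assoc, sub_eq_add_neg,
    fromBlocks_neg, fromBlocks_add, neg_neg]

/-- `det [[0, −1],[−1, G]] = (−1)^{|μ|}` (the middle block is unimodular whatever `G` is: "the step has unit
Jacobian"). [folklore] -/
theorem det_mid (G : Matrix μ μ 𝕜) : (mid G).det = (-1) ^ Fintype.card μ := by
  unfold mid
  have h : fromBlocks (1 : Matrix μ μ 𝕜) (0 : Matrix μ μ 𝕜) G (1 : Matrix μ μ 𝕜)
      * fromBlocks (0 : Matrix μ μ 𝕜) (-1 : Matrix μ μ 𝕜) (-1 : Matrix μ μ 𝕜) G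
      * fromBlocks (1 : Matrix μ μ 𝕜) (-1 : Matrix μ μ 𝕜) (0 : Matrix μ μ 𝕜) (1 : Matrix μ μ 𝕜)
      = fromBlocks (0 : Matrix μ μ 𝕜) (-1 : Matrix μ μ 𝕜) (-1 : Matrix μ μ 𝕜) (0 : Matrix μ μ 𝕜)
      * fromBlocks (1 : Matrix μ μ 𝕜) (-1 : Matrix μ μ 𝕜) (0 : Matrix μ μ 𝕜) (1 : Matrix μ μ 𝕜) := by
    simp [fromBlocks_multiply]
  have h2 : fromBlocks (0 : Matrix μ μ 𝕜) (-1 : Matrix μ μ 𝕜) (-1 : Matrix μ μ 𝕜) (0 : Matrix μ μ 𝕜)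
      * fromBlocks (1 : Matrix μ μ 𝕜) (-1 : Matrix μ μ 𝕜) (0 : Matrix μ μ 𝕜) (1 : Matrix μ μ 𝕜)
      = fromBlocks (0 : Matrix μ μ 𝕜) (-1 : Matrix μ μ 𝕜) (-1 : Matrix μ μ 𝕜) (1 : Matrix μ μ 𝕜) := by
    simp [fromBlocks_multiply]
  have hd := congrArg Matrix.det h
  rw [h2, det_mul, det_mul, det_fromBlocks_zero₁₂, det_fromBlocks_zero₂₁, det_one, one_mul, mul_one, one_mul,
    det_fromBlocks_one₂₂] at hd
  rw [hd]
  simp [det_neg]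

/-- FIRST FACTORISATION (integrate the fine field first): if the first-step bordered matrix is invertible, then
`det unint = det kkt(H, Q₁) · det kkt(effForm H Q₁ + G, Q₂)`. [folklore] -/
theorem det_unint (H : Matrix ν ν 𝕜) (Q₁ : Matrix μ ν 𝕜) (G : Matrix μ μ 𝕜) (Q₂ : Matrix κ μ 𝕜)
    (h : IsUnit (kkt H Q₁).det) :
    (unint H Q₁ G Q₂).det = (kkt H Q₁).det * (kkt (effForm H Q₁ + G) Q₂).det := by
  letI : Invertible (kkt H Q₁) := Matrix.invertibleOfIsUnitDet _ h
  unfold unint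
  rw [det_fromBlocks₁₁, Matrix.invOf_eq_nonsing_inv, schur_unint]
  rfl

/-- SECOND FACTORISATION (integrate the block field and the first multiplier first — that block is unimodular):
`det unint' = (−1)^{|μ|} · det kkt(H + Q₁ᵀ G Q₁, Q₂ Q₁)`, unconditionally. [folklore] -/
theorem det_unint' (H : Matrix ν ν 𝕜) (Q₁ : Matrix μ ν 𝕜) (G : Matrix μ μ 𝕜) (Q₂ : Matrix κ μ 𝕜) :
    (unint' H Q₁ G Q₂).det = (-1) ^ Fintype.card μ * (kkt (compForm H Q₁ G) (Q₂ * Q₁)).det := by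
  letI : Invertible (mid G) := midInvertible G
  unfold unint'
  rw [det_fromBlocks₂₂, det_mid]
  congr 1
  have hinv : ⅟(mid G) = midInv G := rfl
  rw [hinv, schur_unint']

/-- THE COMPOSITION LAW UNDER THE SINGLE BORDERED HYPOTHESIS: if `kkt H Q₁` is invertible (`Q₁` onto, `H` non-degenerate
on `ker Q₁` — `H` itself may be singular), then for every `G`, `Q₂`:
`det kkt(H + Q₁ᵀ G Q₁, Q₂ Q₁) = (−1)^{|μ|} · det kkt(H, Q₁) · det kkt(effForm H Q₁ + G, Q₂)`.
Compare `Composition.det_kkt_compForm` (three invertibility hypotheses, effective form `(Q₁H⁻¹Q₁ᵀ)⁻¹`). [folklore] -/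
theorem det_kkt_compForm_of_kkt (H : Matrix ν ν 𝕜) (Q₁ : Matrix μ ν 𝕜) (G : Matrix μ μ 𝕜) (Q₂ : Matrix κ μ 𝕜)
    (h : IsUnit (kkt H Q₁).det) :
    (kkt (compForm H Q₁ G) (Q₂ * Q₁)).det =
      (-1) ^ Fintype.card μ * ((kkt H Q₁).det * (kkt (effForm H Q₁ + G) Q₂).det) := by
  have hsq : ((-1 : 𝕜) ^ Fintype.card μ) * (-1) ^ Fintype.card μ = 1 := by
    rw [← mul_pow, neg_mul_neg, one_mul, one_pow]
  have h12 : (unint H Q₁ G Q₂).det = (unint' H Q₁ G Q₂).det := by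
    rw [unint_eq_submatrix, Matrix.det_submatrix_equiv_self]
  rw [← det_unint H Q₁ G Q₂ h, h12, det_unint', ← mul_assoc, hsq, one_mul]

/-- Non-degeneracy transfer: under `IsUnit (kkt H Q₁).det`, the composite bordered matrix is non-degenerate iff the
second-step one (with the effective form) is. [folklore] -/
theorem det_kkt_compForm_ne_zero_iff (H : Matrix ν ν 𝕜) (Q₁ : Matrix μ ν 𝕜) (G : Matrix μ μ 𝕜) (Q₂ : Matrix κ μ 𝕜)
    (h : IsUnit (kkt H Q₁).det) :
    (kkt (compForm H Q₁ G) (Q₂ * Q₁)).det ≠ 0 ↔ (kkt (effForm H Q₁ + G) Q₂).det ≠ 0 := by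
  rw [det_kkt_compForm_of_kkt H Q₁ G Q₂ h]
  have hs : ((-1 : 𝕜) ^ Fintype.card μ) ≠ 0 := pow_ne_zero _ (neg_ne_zero.mpr one_ne_zero)
  have h1 : (kkt H Q₁).det ≠ 0 := h.ne_zero
  constructor
  · intro hne h0
    exact hne (by rw [h0, mul_zero, mul_zero])
  · intro hne
    exact mul_ne_zero hs (mul_ne_zero h1 hne)

/-- `IsUnit` form of the transfer. [folklore] -/
theorem isUnit_det_kkt_compForm (H : Matrix ν ν 𝕜) (Q₁ : Matrix μ ν 𝕜) (G : Matrix μ μ 𝕜) (Q₂ : Matrix κ μ 𝕜)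
    (h1 : IsUnit (kkt H Q₁).det) (h2 : IsUnit (kkt (effForm H Q₁ + G) Q₂).det) :
    IsUnit (kkt (compForm H Q₁ G) (Q₂ * Q₁)).det :=
  isUnit_iff_ne_zero.mpr ((det_kkt_compForm_ne_zero_iff H Q₁ G Q₂ h1).mpr h2.ne_zero)

/-! ## §3. Consistency with `Composition` / `Envelope`: for invertible `H` the three blocks are the classical objects -/

/-- For `H` invertible with invertible block propagator `P = Q H⁻¹ Qᵀ`: `effForm H Q = P⁻¹`, `minOp H Q = Envelope.minMap H Q
= H⁻¹QᵀP⁻¹` ([Balaban1985BackgroundPropagators] (3.126) `H = GQ*(QGQ*)⁻¹` pattern), `minOpL H Q = Envelope.minMapL H Q`,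
`flucCov H Q = Envelope.constrProp H Q = H⁻¹ − H⁻¹QᵀP⁻¹QH⁻¹` — read off `Envelope.kkt_inv` (consumed by name). [folklore] -/
theorem blocks_eq_of_inv (H : Matrix ν ν 𝕜) (Q : Matrix μ ν 𝕜) (hH : IsUnit H.det) (hP : IsUnit (blockProp H Q).det) :
    effForm H Q = (blockProp H Q)⁻¹ ∧ minOp H Q = Envelope.minMap H Q ∧ minOpL H Q = Envelope.minMapL H Q ∧
      flucCov H Q = Envelope.constrProp H Q := by
  unfold effForm minOp minOpL flucCov
  rw [Envelope.kkt_inv H Q hH hP, toBlocks_fromBlocks₂₂, toBlocks_fromBlocks₁₂, toBlocks_fromBlocks₂₁,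
    toBlocks_fromBlocks₁₁, neg_neg]
  exact ⟨rfl, rfl, rfl, rfl⟩

/-- In particular `effForm H Q = (Q H⁻¹ Qᵀ)⁻¹` for invertible `H`, `P`. [folklore] -/
theorem effForm_eq_blockProp_inv (H : Matrix ν ν 𝕜) (Q : Matrix μ ν 𝕜) (hH : IsUnit H.det)
    (hP : IsUnit (blockProp H Q).det) : effForm H Q = (blockProp H Q)⁻¹ :=
  (blocks_eq_of_inv H Q hH hP).1

/-- … and `minOp H Q = H⁻¹ Qᵀ (Q H⁻¹ Qᵀ)⁻¹`. [folklore] -/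
theorem minOp_eq_minMap (H : Matrix ν ν 𝕜) (Q : Matrix μ ν 𝕜) (hH : IsUnit H.det)
    (hP : IsUnit (blockProp H Q).det) : minOp H Q = H⁻¹ * Qᵀ * (blockProp H Q)⁻¹ :=
  (blocks_eq_of_inv H Q hH hP).2.1

/-- … and `flucCov H Q = Envelope.constrProp H Q`. [folklore] -/
theorem flucCov_eq_constrProp (H : Matrix ν ν 𝕜) (Q : Matrix μ ν 𝕜) (hH : IsUnit H.det)
    (hP : IsUnit (blockProp H Q).det) : flucCov H Q = Envelope.constrProp H Q :=
  (blocks_eq_of_inv H Q hH hP).2.2.2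

/-- Hence `Composition.det_kkt_compForm` WITHOUT its third hypothesis (invertibility of the composite form): for `H` and
`P = Q₁ H⁻¹ Q₁ᵀ` invertible, `det kkt(H + Q₁ᵀGQ₁, Q₂Q₁) = (−1)^{|μ|} det kkt(H,Q₁) · det kkt(P⁻¹ + G, Q₂)`. [folklore] -/
theorem det_kkt_compForm_of_inv (H : Matrix ν ν 𝕜) (Q₁ : Matrix μ ν 𝕜) (G : Matrix μ μ 𝕜) (Q₂ : Matrix κ μ 𝕜)
    (hH : IsUnit H.det) (hP : IsUnit (blockProp H Q₁).det) :
    (kkt (compForm H Q₁ G) (Q₂ * Q₁)).det =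
      (-1) ^ Fintype.card μ * ((kkt H Q₁).det * (kkt ((blockProp H Q₁)⁻¹ + G) Q₂).det) := by
  rw [← effForm_eq_blockProp_inv H Q₁ hH hP]
  exact det_kkt_compForm_of_kkt H Q₁ G Q₂ (isUnit_iff_ne_zero.mpr (det_kkt_ne_zero H Q₁ hH hP))

/-! ## §4. The `a`-shift: regularising the fine form by `Qᵀ A Q` shifts the effective form by `A` and nothing else -/

/-- `rowOp Q A · [[1, −QᵀA],[0, 1]] = 1`. [folklore] -/
theorem rowOp_mul_inv (Q : Matrix μ ν 𝕜) (A : Matrix μ μ 𝕜) :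
    rowOp Q A * fromBlocks 1 (-(Qᵀ * A)) 0 1 = 1 := by
  unfold rowOp
  rw [fromBlocks_multiply, ← fromBlocks_one]
  simp

/-- The bordered inverse of the regularised datum: `(kkt (H + QᵀAQ) Q)⁻¹ = (kkt H Q)⁻¹ · [[1, −QᵀA],[0, 1]]`
(`KKTSplit.kkt_add_conj_eq`). [folklore] -/
theorem kktInv_add_conj (H : Matrix ν ν 𝕜) (Q : Matrix μ ν 𝕜) (A : Matrix μ μ 𝕜) :
    (kkt (H + Qᵀ * A * Q) Q)⁻¹ = (kkt H Q)⁻¹ * fromBlocks 1 (-(Qᵀ * A)) 0 1 := by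
  rw [kkt_add_conj_eq, Matrix.mul_inv_rev, Matrix.inv_eq_right_inv (rowOp_mul_inv Q A)]

/-- THE `a`-SHIFT, all four blocks: if `kkt H Q` is invertible then for EVERY square `A`, regularising the fine form by
`Qᵀ A Q` (invisible on `ker Q`) leaves the fluctuation covariance, the minimiser and its left companion UNCHANGED and
shifts the effective form by exactly `A`:  `flucCov, minOp, minOpL (H + QᵀAQ) Q = … H Q`,
`effForm (H + QᵀAQ) Q = effForm H Q + A`.  (Bałaban's `a‖QA‖²` term of (3.111)/(3.122): constant on the constraint
surface, it changes neither `H` of (3.126) nor the fluctuation propagator.) [folklore] -/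
theorem blocks_add_conj (H : Matrix ν ν 𝕜) (Q : Matrix μ ν 𝕜) (A : Matrix μ μ 𝕜) (h : IsUnit (kkt H Q).det) :
    flucCov (H + Qᵀ * A * Q) Q = flucCov H Q ∧ minOp (H + Qᵀ * A * Q) Q = minOp H Q ∧
      minOpL (H + Qᵀ * A * Q) Q = minOpL H Q ∧ effForm (H + Qᵀ * A * Q) Q = effForm H Q + A := by
  have h21 : minOpL H Q * Qᵀ = 1 := minOpL_mul_transpose H Q h
  have h11 : flucCov H Q * Qᵀ = 0 := flucCov_mul_transpose H Q h
  have key : (kkt (H + Qᵀ * A * Q) Q)⁻¹ =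
      fromBlocks (flucCov H Q) (minOp H Q) (minOpL H Q) (-(effForm H Q + A)) := by
    rw [kktInv_add_conj, kktInv_eq_fromBlocks H Q, fromBlocks_multiply]
    simp only [Matrix.mul_one, Matrix.mul_zero, add_zero, zero_add, Matrix.mul_neg, ← Matrix.mul_assoc, h11, h21,
      Matrix.zero_mul, Matrix.one_mul, neg_zero, neg_add_rev]
  unfold flucCov minOp minOpL effForm
  rw [key, toBlocks_fromBlocks₁₁, toBlocks_fromBlocks₁₂, toBlocks_fromBlocks₂₁, toBlocks_fromBlocks₂₂, neg_neg]
  refine ⟨rfl, rfl, rfl, ?_⟩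
  rfl

/-- THE `a`-SHIFT of the effective form alone: `effForm (H + Qᵀ A Q) Q = effForm H Q + A`. [folklore] -/
theorem effForm_add_conj (H : Matrix ν ν 𝕜) (Q : Matrix μ ν 𝕜) (A : Matrix μ μ 𝕜) (h : IsUnit (kkt H Q).det) :
    effForm (H + Qᵀ * A * Q) Q = effForm H Q + A :=
  (blocks_add_conj H Q A h).2.2.2

/-- `a`-INDEPENDENCE of the minimiser: `minOp (H + Qᵀ A Q) Q = minOp H Q`. [folklore] -/
theorem minOp_add_conj (H : Matrix ν ν 𝕜) (Q : Matrix μ ν 𝕜) (A : Matrix μ μ 𝕜) (h : IsUnit (kkt H Q).det) :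
    minOp (H + Qᵀ * A * Q) Q = minOp H Q :=
  (blocks_add_conj H Q A h).2.1

/-- `a`-INDEPENDENCE of the fluctuation covariance: `flucCov (H + Qᵀ A Q) Q = flucCov H Q`. [folklore] -/
theorem flucCov_add_conj (H : Matrix ν ν 𝕜) (Q : Matrix μ ν 𝕜) (A : Matrix μ μ 𝕜) (h : IsUnit (kkt H Q).det) :
    flucCov (H + Qᵀ * A * Q) Q = flucCov H Q :=
  (blocks_add_conj H Q A h).1

/-- The regularised form has an invertible bordered matrix iff the bare one does (same determinant,
`KKTSplit.det_kkt_add_conj`); in particular the single hypothesis `IsUnit (kkt H Q).det` of this file FOLLOWS from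
Bałaban-type regularity: `K := H + QᵀAQ` and `Q K⁻¹ Qᵀ` invertible. [folklore] -/
theorem isUnit_kkt_det_of_reg (H : Matrix ν ν 𝕜) (Q : Matrix μ ν 𝕜) (A : Matrix μ μ 𝕜)
    (hK : IsUnit (H + Qᵀ * A * Q).det) (hP : IsUnit (blockProp (H + Qᵀ * A * Q) Q).det) :
    IsUnit (kkt H Q).det := by
  have hKkt : IsUnit (kkt (H + Qᵀ * A * Q) Q).det := isUnit_iff_ne_zero.mpr (det_kkt_ne_zero _ _ hK hP)
  rwa [det_kkt_add_conj] at hKkt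

/-- BAŁABAN'S REGULARISED READING of the three blocks ([Balaban1985BackgroundPropagators] p. 420: (3.122)
`G⁻¹ = Δ_π + DRD* + Q*aQ`, (3.126) `HB = GQ*(QGQ*)⁻¹B`; p. 428 (3.156) `⟨B,(QG₁Q*)⁻¹B⟩ − a⟨B,B⟩ …`): with `K := H + QᵀAQ`
and `P_K := Q K⁻¹ Qᵀ` invertible and `H` POSSIBLY SINGULAR,
`effForm H Q = P_K⁻¹ − A`, `minOp H Q = K⁻¹ Qᵀ P_K⁻¹`, `flucCov H Q = K⁻¹ − K⁻¹QᵀP_K⁻¹QK⁻¹`. [folklore] -/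
theorem blocks_eq_of_reg (H : Matrix ν ν 𝕜) (Q : Matrix μ ν 𝕜) (A : Matrix μ μ 𝕜)
    (hK : IsUnit (H + Qᵀ * A * Q).det) (hP : IsUnit (blockProp (H + Qᵀ * A * Q) Q).det) :
    effForm H Q = (blockProp (H + Qᵀ * A * Q) Q)⁻¹ - A ∧
      minOp H Q = (H + Qᵀ * A * Q)⁻¹ * Qᵀ * (blockProp (H + Qᵀ * A * Q) Q)⁻¹ ∧
      flucCov H Q = Envelope.constrProp (H + Qᵀ * A * Q) Q := by
  have hkkt : IsUnit (kkt H Q).det := isUnit_kkt_det_of_reg H Q A hK hP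
  obtain ⟨hc, hm, -, he⟩ := blocks_add_conj H Q A hkkt
  obtain ⟨he', hm', -, hc'⟩ := blocks_eq_of_inv (H + Qᵀ * A * Q) Q hK hP
  refine ⟨?_, ?_, ?_⟩
  · rw [eq_sub_iff_add_eq, ← he, he']
  · rw [← hm, hm']
    rfl
  · rw [← hc, hc']

/-- The effective-form half alone: `effForm H Q = (Q K⁻¹ Qᵀ)⁻¹ − A`, `K = H + QᵀAQ` — "`(QG₁Q*)⁻¹ − a`". [folklore] -/
theorem effForm_eq_of_reg (H : Matrix ν ν 𝕜) (Q : Matrix μ ν 𝕜) (A : Matrix μ μ 𝕜)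
    (hK : IsUnit (H + Qᵀ * A * Q).det) (hP : IsUnit (blockProp (H + Qᵀ * A * Q) Q).det) :
    effForm H Q = (blockProp (H + Qᵀ * A * Q) Q)⁻¹ - A :=
  (blocks_eq_of_reg H Q A hK hP).1

/-- THE COMPOSITION LAW IN BAŁABAN'S REGULARISED VARIABLES: with `K := H + Q₁ᵀ A Q₁` and `P_K := Q₁ K⁻¹ Q₁ᵀ` invertible,
`det kkt(H + Q₁ᵀ G Q₁, Q₂ Q₁) = (−1)^{|μ|} · det kkt(H, Q₁) · det kkt(P_K⁻¹ − A + G, Q₂)` — the next step's form is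
"`(QG₁Q*)⁻¹ − a`" plus the step's own weight `G`, for a fine form `H` that may be singular. [folklore] -/
theorem det_kkt_compForm_reg (H : Matrix ν ν 𝕜) (Q₁ : Matrix μ ν 𝕜) (A G : Matrix μ μ 𝕜) (Q₂ : Matrix κ μ 𝕜)
    (hK : IsUnit (H + Q₁ᵀ * A * Q₁).det) (hP : IsUnit (blockProp (H + Q₁ᵀ * A * Q₁) Q₁).det) :
    (kkt (compForm H Q₁ G) (Q₂ * Q₁)).det =
      (-1) ^ Fintype.card μ * ((kkt H Q₁).det * (kkt ((blockProp (H + Q₁ᵀ * A * Q₁) Q₁)⁻¹ - A + G) Q₂).det) := by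
  rw [← effForm_eq_of_reg H Q₁ A hK hP]
  exact det_kkt_compForm_of_kkt H Q₁ G Q₂ (isUnit_kkt_det_of_reg H Q₁ A hK hP)

/-! ## §5. The inverse of the un-integrated matrix in the two groupings; COMPOSITION of the three blocks -/

/-- FIRST GROUPING, the whole inverse: with `X := (kkt H Q₁)⁻¹`, `Y := (kkt (effForm H Q₁ + G) Q₂)⁻¹` both genuine
inverses, `unint⁻¹ = [[X + X·cpl₁₂·Y·cpl₂₁·X, −X·cpl₁₂·Y],[−Y·cpl₂₁·X, Y]]` (Mathlib's `Matrix.invOf_fromBlocks₁₁_eq` with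
the Schur complement `schur_unint`). [folklore] -/
theorem unintInv_eq (H : Matrix ν ν 𝕜) (Q₁ : Matrix μ ν 𝕜) (G : Matrix μ μ 𝕜) (Q₂ : Matrix κ μ 𝕜)
    (h1 : IsUnit (kkt H Q₁).det) (h2 : IsUnit (kkt (effForm H Q₁ + G) Q₂).det) :
    (unint H Q₁ G Q₂)⁻¹ =
      fromBlocks
        ((kkt H Q₁)⁻¹ + (kkt H Q₁)⁻¹ * cpl₁₂ 𝕜 ν μ κ * (kkt (effForm H Q₁ + G) Q₂)⁻¹ * cpl₂₁ 𝕜 ν μ κ * (kkt H Q₁)⁻¹)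
        (-((kkt H Q₁)⁻¹ * cpl₁₂ 𝕜 ν μ κ * (kkt (effForm H Q₁ + G) Q₂)⁻¹))
        (-((kkt (effForm H Q₁ + G) Q₂)⁻¹ * cpl₂₁ 𝕜 ν μ κ * (kkt H Q₁)⁻¹))
        (kkt (effForm H Q₁ + G) Q₂)⁻¹ := by
  letI : Invertible (kkt H Q₁) := Matrix.invertibleOfIsUnitDet _ h1
  have hS : kkt G Q₂ - cpl₂₁ 𝕜 ν μ κ * ⅟(kkt H Q₁) * cpl₁₂ 𝕜 ν μ κ = kkt (effForm H Q₁ + G) Q₂ := by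
    rw [Matrix.invOf_eq_nonsing_inv, schur_unint]
    rfl
  letI : Invertible (kkt G Q₂ - cpl₂₁ 𝕜 ν μ κ * ⅟(kkt H Q₁) * cpl₁₂ 𝕜 ν μ κ) :=
    (Matrix.invertibleOfIsUnitDet _ h2).copy _ hS
  letI : Invertible (fromBlocks (kkt H Q₁) (cpl₁₂ 𝕜 ν μ κ) (cpl₂₁ 𝕜 ν μ κ) (kkt G Q₂)) :=
    Matrix.fromBlocks₁₁Invertible _ _ _ _
  have e := Matrix.invOf_fromBlocks₁₁_eq (kkt H Q₁) (cpl₁₂ 𝕜 ν μ κ) (cpl₂₁ 𝕜 ν μ κ) (kkt G Q₂)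
  simp only [Matrix.invOf_eq_nonsing_inv] at e
  rw [schur_unint] at e
  exact e

/-- SECOND GROUPING, the corner we need: the (fine field ⊕ second multiplier) block of `unint'⁻¹` is the bordered inverse
of the COMPOSITE datum, `(kkt (H + Q₁ᵀGQ₁) (Q₂Q₁))⁻¹` (Mathlib's `Matrix.invOf_fromBlocks₂₂_eq` with the unimodular middle
block and the Schur complement `schur_unint'`). [folklore] -/
theorem unint'Inv_toBlocks₁₁ (H : Matrix ν ν 𝕜) (Q₁ : Matrix μ ν 𝕜) (G : Matrix μ μ 𝕜) (Q₂ : Matrix κ μ 𝕜)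
    (h1 : IsUnit (kkt H Q₁).det) (h2 : IsUnit (kkt (effForm H Q₁ + G) Q₂).det) :
    ((unint' H Q₁ G Q₂)⁻¹).toBlocks₁₁ = (kkt (compForm H Q₁ G) (Q₂ * Q₁))⁻¹ := by
  letI : Invertible (mid G) := midInvertible G
  have hS : outer H κ - om Q₁ Q₂ * ⅟(mid G) * mo Q₁ Q₂ = kkt (compForm H Q₁ G) (Q₂ * Q₁) := by
    have hinv : ⅟(mid G) = midInv G := rfl
    rw [hinv, schur_unint']
  letI : Invertible (outer H κ - om Q₁ Q₂ * ⅟(mid G) * mo Q₁ Q₂) :=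
    (Matrix.invertibleOfIsUnitDet _ (isUnit_det_kkt_compForm H Q₁ G Q₂ h1 h2)).copy _ hS
  letI : Invertible (fromBlocks (outer H κ) (om Q₁ Q₂) (mo Q₁ Q₂) (mid G)) := Matrix.fromBlocks₂₂Invertible _ _ _ _
  have e := congrArg Matrix.toBlocks₁₁ (Matrix.invOf_fromBlocks₂₂_eq (outer H κ) (om Q₁ Q₂) (mo Q₁ Q₂) (mid G))
  rw [toBlocks_fromBlocks₁₁] at e
  simp only [Matrix.invOf_eq_nonsing_inv] at e
  rw [Matrix.inv_eq_right_inv (mid_mul_midInv G), schur_unint'] at e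
  exact e

/-- ENTRY TRANSFER between the groupings: the bordered inverse of the composite datum, entry by entry, is an entry of
`unint⁻¹` (fine-field index `x ↦ inl (inl x)`, second-multiplier index `l ↦ inr (inr l)`). [folklore] -/
theorem kktInv_compForm_apply (H : Matrix ν ν 𝕜) (Q₁ : Matrix μ ν 𝕜) (G : Matrix μ μ 𝕜) (Q₂ : Matrix κ μ 𝕜)
    (h1 : IsUnit (kkt H Q₁).det) (h2 : IsUnit (kkt (effForm H Q₁ + G) Q₂).det) (i j : ν ⊕ κ) :
    ((kkt (compForm H Q₁ G) (Q₂ * Q₁))⁻¹) i j =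
      ((unint H Q₁ G Q₂)⁻¹) (Sum.elim (fun x => Sum.inl (Sum.inl x)) (fun l => Sum.inr (Sum.inr l)) i)
        (Sum.elim (fun x => Sum.inl (Sum.inl x)) (fun l => Sum.inr (Sum.inr l)) j) := by
  rw [← unint'Inv_toBlocks₁₁ H Q₁ G Q₂ h1 h2, unintInv_eq_submatrix]
  rcases i with x | l <;> rcases j with x' | l' <;> rfl

/-- COMPOSITION OF EFFECTIVE FORMS: `effForm (H + Q₁ᵀ G Q₁) (Q₂ Q₁) = effForm (effForm H Q₁ + G) Q₂` — "integrate the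
fine field against the composite constraint" and "integrate it against `Q₁`, add `G`, integrate the block field against
`Q₂`" leave the same effective form for the coarsest variable.  Compare `Composition.blockProp_compForm_mul`
(invertible `H`). [folklore] -/
theorem effForm_compForm (H : Matrix ν ν 𝕜) (Q₁ : Matrix μ ν 𝕜) (G : Matrix μ μ 𝕜) (Q₂ : Matrix κ μ 𝕜)
    (h1 : IsUnit (kkt H Q₁).det) (h2 : IsUnit (kkt (effForm H Q₁ + G) Q₂).det) :
    effForm (compForm H Q₁ G) (Q₂ * Q₁) = effForm (effForm H Q₁ + G) Q₂ := by
  ext l l'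
  change -(((kkt (compForm H Q₁ G) (Q₂ * Q₁))⁻¹) (Sum.inr l) (Sum.inr l')) =
    -(((kkt (effForm H Q₁ + G) Q₂)⁻¹) (Sum.inr l) (Sum.inr l'))
  rw [kktInv_compForm_apply H Q₁ G Q₂ h1 h2, unintInv_eq H Q₁ G Q₂ h1 h2]
  rfl

/-- COMPOSITION OF MINIMISERS (background fields compose): `minOp (H + Q₁ᵀ G Q₁) (Q₂ Q₁) = minOp H Q₁ · minOp (effForm H Q₁ + G) Q₂`
— the fine-lattice minimiser with prescribed COARSEST average `z` is the fine minimiser with prescribed block average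
`y*(z)`, where `y*(z)` minimises the effective-plus-step form with prescribed `Q₂`-average `z`. [folklore] -/
theorem minOp_compForm (H : Matrix ν ν 𝕜) (Q₁ : Matrix μ ν 𝕜) (G : Matrix μ μ 𝕜) (Q₂ : Matrix κ μ 𝕜)
    (h1 : IsUnit (kkt H Q₁).det) (h2 : IsUnit (kkt (effForm H Q₁ + G) Q₂).det) :
    minOp (compForm H Q₁ G) (Q₂ * Q₁) = minOp H Q₁ * minOp (effForm H Q₁ + G) Q₂ := by
  ext x l
  change ((kkt (compForm H Q₁ G) (Q₂ * Q₁))⁻¹) (Sum.inl x) (Sum.inr l) = _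
  rw [kktInv_compForm_apply H Q₁ G Q₂ h1 h2, unintInv_eq H Q₁ G Q₂ h1 h2]
  change (-((kkt H Q₁)⁻¹ * cpl₁₂ 𝕜 ν μ κ * (kkt (effForm H Q₁ + G) Q₂)⁻¹)) (Sum.inl x) (Sum.inr l) = _
  rw [neg_mul_cpl₁₂_mul]
  rfl

/-- COMPOSITION OF LEFT COMPANIONS: `minOpL (H + Q₁ᵀ G Q₁) (Q₂ Q₁) = minOpL (effForm H Q₁ + G) Q₂ · minOpL H Q₁`. [folklore] -/
theorem minOpL_compForm (H : Matrix ν ν 𝕜) (Q₁ : Matrix μ ν 𝕜) (G : Matrix μ μ 𝕜) (Q₂ : Matrix κ μ 𝕜)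
    (h1 : IsUnit (kkt H Q₁).det) (h2 : IsUnit (kkt (effForm H Q₁ + G) Q₂).det) :
    minOpL (compForm H Q₁ G) (Q₂ * Q₁) = minOpL (effForm H Q₁ + G) Q₂ * minOpL H Q₁ := by
  ext l x
  change ((kkt (compForm H Q₁ G) (Q₂ * Q₁))⁻¹) (Sum.inr l) (Sum.inl x) = _
  rw [kktInv_compForm_apply H Q₁ G Q₂ h1 h2, unintInv_eq H Q₁ G Q₂ h1 h2]
  change (-((kkt (effForm H Q₁ + G) Q₂)⁻¹ * cpl₂₁ 𝕜 ν μ κ * (kkt H Q₁)⁻¹)) (Sum.inr l) (Sum.inl x) = _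
  rw [neg_mul_cpl₂₁_mul]
  rfl

/-- TELESCOPING OF FLUCTUATION COVARIANCES: `flucCov (H + Q₁ᵀ G Q₁) (Q₂ Q₁) = flucCov H Q₁ + minOp H Q₁ · flucCov (effForm H Q₁ + G) Q₂ · minOpL H Q₁`
— the fluctuation about the composite constraint = the fine fluctuation about the `Q₁`-constraint PLUS the block
field's fluctuation transported to the fine lattice by the minimiser (the finite-dimensional shape of a two-step
telescopic decomposition of the propagator; orientation only). [folklore] -/
theorem flucCov_compForm (H : Matrix ν ν 𝕜) (Q₁ : Matrix μ ν 𝕜) (G : Matrix μ μ 𝕜) (Q₂ : Matrix κ μ 𝕜)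
    (h1 : IsUnit (kkt H Q₁).det) (h2 : IsUnit (kkt (effForm H Q₁ + G) Q₂).det) :
    flucCov (compForm H Q₁ G) (Q₂ * Q₁) = flucCov H Q₁ + minOp H Q₁ * flucCov (effForm H Q₁ + G) Q₂ * minOpL H Q₁ := by
  ext x x'
  change ((kkt (compForm H Q₁ G) (Q₂ * Q₁))⁻¹) (Sum.inl x) (Sum.inl x') = _
  rw [kktInv_compForm_apply H Q₁ G Q₂ h1 h2, unintInv_eq H Q₁ G Q₂ h1 h2]
  change ((kkt H Q₁)⁻¹ + (kkt H Q₁)⁻¹ * cpl₁₂ 𝕜 ν μ κ * (kkt (effForm H Q₁ + G) Q₂)⁻¹ * cpl₂₁ 𝕜 ν μ κ * (kkt H Q₁)⁻¹)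
    (Sum.inl x) (Sum.inl x') = _
  rw [mul_cpl₁₂_mul_mul_cpl₂₁_mul, Matrix.add_apply, Matrix.add_apply]
  rfl

end Field

/-! ## §6. Over `ℝ`: additivity of `log Z` under the single bordered hypothesis -/

section RealTwoLevel

variable {ν μ κ : Type*} [Fintype ν] [Fintype μ] [Fintype κ] [DecidableEq ν] [DecidableEq μ] [DecidableEq κ]

/-- `|det kkt(H + Q₁ᵀGQ₁, Q₂Q₁)| = |det kkt(H,Q₁)| · |det kkt(effForm H Q₁ + G, Q₂)|`. [folklore] -/
theorem abs_det_kkt_compForm_of_kkt (H : Matrix ν ν ℝ) (Q₁ : Matrix μ ν ℝ) (G : Matrix μ μ ℝ) (Q₂ : Matrix κ μ ℝ)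
    (h : (kkt H Q₁).det ≠ 0) :
    |(kkt (compForm H Q₁ G) (Q₂ * Q₁)).det| = |(kkt H Q₁).det| * |(kkt (effForm H Q₁ + G) Q₂).det| := by
  rw [det_kkt_compForm_of_kkt H Q₁ G Q₂ (isUnit_iff_ne_zero.mpr h), abs_mul, abs_mul, abs_pow, abs_neg, abs_one,
    one_pow, one_mul]

/-- ADDITIVITY OF `log Z` WITHOUT INVERTIBILITY OF THE FINE FORM: if neither bordered determinant vanishes,
`logZ (H + Q₁ᵀ G Q₁) (Q₂ Q₁) = logZ H Q₁ + logZ (effForm H Q₁ + G) Q₂` (compare `Composition.logZ_compForm`, four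
hypotheses). [folklore] -/
theorem logZ_compForm_of_kkt (H : Matrix ν ν ℝ) (Q₁ : Matrix μ ν ℝ) (G : Matrix μ μ ℝ) (Q₂ : Matrix κ μ ℝ)
    (h1 : (kkt H Q₁).det ≠ 0) (h2 : (kkt (effForm H Q₁ + G) Q₂).det ≠ 0) :
    logZ (compForm H Q₁ G) (Q₂ * Q₁) = logZ H Q₁ + logZ (effForm H Q₁ + G) Q₂ := by
  unfold logZ
  rw [abs_det_kkt_compForm_of_kkt H Q₁ G Q₂ h1, Real.log_mul (abs_ne_zero.mpr h1) (abs_ne_zero.mpr h2)]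
  ring

end RealTwoLevel

/-! ## §7. The k-fold iterate through bordered inverses -/

section ChainSec

variable {𝕜 : Type*} [Field 𝕜] {Λ : ℕ → Type*} [∀ j, Fintype (Λ j)] [∀ j, DecidableEq (Λ j)]

/-- The effective form on level `j` produced by integrating levels `0, …, j−1` THROUGH BORDERED INVERSES:
`seff 0 = H0`, `seff (j+1) = effForm (seff j + G j) (Q j)` — defined for singular step forms too (compare
`Composition.Chain.eff`, which inverts the step form). [folklore] -/
def seff (c : Chain 𝕜 Λ) : (j : ℕ) → Matrix (Λ j) (Λ j) 𝕜
  | 0 => c.H0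
  | j + 1 => effForm (seff c j + c.G j) (c.Q j)

/-- The form integrated at the step that integrates level `j`: `seff j + G j`. [folklore] -/
def sstep (c : Chain 𝕜 Λ) (j : ℕ) : Matrix (Λ j) (Λ j) 𝕜 := seff c j + c.G j

/-- The COMPOSED MINIMISER from level `k` down to level `0`: `sminOp 0 = 1`,
`sminOp (k+1) = sminOp k · minOp (sstep k) (Q k)`. [folklore] -/
def sminOp (c : Chain 𝕜 Λ) : (k : ℕ) → Matrix (Λ 0) (Λ k) 𝕜
  | 0 => 1
  | k + 1 => sminOp c k * minOp (sstep c k) (c.Q k)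

/-- The composed left companion: `sminOpL 0 = 1`, `sminOpL (k+1) = minOpL (sstep k) (Q k) · sminOpL k`. [folklore] -/
def sminOpL (c : Chain 𝕜 Λ) : (k : ℕ) → Matrix (Λ k) (Λ 0) 𝕜
  | 0 => 1
  | k + 1 => minOpL (sstep c k) (c.Q k) * sminOpL c k

/-- Unfolding: `seff c 0 = H0`. [folklore] -/
theorem seff_zero (c : Chain 𝕜 Λ) : seff c 0 = c.H0 := rfl

/-- Unfolding: `seff c (j+1) = effForm (sstep c j) (Q j)`. [folklore] -/
theorem seff_succ (c : Chain 𝕜 Λ) (j : ℕ) : seff c (j + 1) = effForm (sstep c j) (c.Q j) := rfl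

/-- Unfolding: `sminOp c 0 = 1`. [folklore] -/
theorem sminOp_zero (c : Chain 𝕜 Λ) : sminOp c 0 = 1 := rfl

/-- Unfolding: `sminOpL c 0 = 1`. [folklore] -/
theorem sminOpL_zero (c : Chain 𝕜 Λ) : sminOpL c 0 = 1 := rfl

/-- Unfolding: `sminOp c (k+1) = sminOp c k · minOp (sstep c k) (Q k)`. [folklore] -/
theorem sminOp_succ (c : Chain 𝕜 Λ) (k : ℕ) : sminOp c (k + 1) = sminOp c k * minOp (sstep c k) (c.Q k) := rfl

/-- Unfolding: `sminOpL c (k+1) = minOpL (sstep c k) (Q k) · sminOpL c k`. [folklore] -/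
theorem sminOpL_succ (c : Chain 𝕜 Λ) (k : ℕ) : sminOpL c (k + 1) = minOpL (sstep c k) (c.Q k) * sminOpL c k := rfl

/-- One step is one step: `total 1 = sstep 0`. [folklore] -/
theorem total_one_eq_sstep (c : Chain 𝕜 Λ) : c.total 1 = sstep c 0 := by
  rw [Chain.total_one]; rfl

/-- THE k-FOLD INVARIANT THROUGH BORDERED INVERSES: if every one-step bordered matrix `kkt (sstep j) (Q j)` (`j ≤ k`) is
invertible, then the one-shot bordered matrix of the first `k+1` steps is invertible, its effective form IS the
iterated one, and its minimiser / left companion ARE the composed ones: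
`effForm (total (k+1)) (compQ (k+1)) = seff (k+1)`, `minOp … = sminOp (k+1)`, `minOpL … = sminOpL (k+1)`. [folklore] -/
theorem scomp_invariant (c : Chain 𝕜 Λ) :
    ∀ k : ℕ, (∀ j ≤ k, IsUnit (kkt (sstep c j) (c.Q j)).det) →
      IsUnit (kkt (c.total (k + 1)) (c.compQ (k + 1))).det ∧
        effForm (c.total (k + 1)) (c.compQ (k + 1)) = seff c (k + 1) ∧
        minOp (c.total (k + 1)) (c.compQ (k + 1)) = sminOp c (k + 1) ∧
        minOpL (c.total (k + 1)) (c.compQ (k + 1)) = sminOpL c (k + 1)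
  | 0, hS => by
      rw [total_one_eq_sstep, Chain.compQ_one, sminOp_succ, sminOpL_succ, sminOp_zero, sminOpL_zero, Matrix.one_mul,
        Matrix.mul_one]
      exact ⟨hS 0 le_rfl, rfl, rfl, rfl⟩
  | k + 1, hS => by
      obtain ⟨hT, hinv, hmin, hminL⟩ := scomp_invariant c k (fun j hj => hS j (Nat.le_succ_of_le hj))
      have hstep : IsUnit (kkt (effForm (c.total (k + 1)) (c.compQ (k + 1)) + c.G (k + 1)) (c.Q (k + 1))).det := by
        rw [hinv]; exact hS (k + 1) le_rfl
      refine ⟨?_, ?_, ?_, ?_⟩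
      · rw [c.total_succ (k + 1), c.compQ_succ (k + 1)]
        exact isUnit_det_kkt_compForm _ _ _ _ hT hstep
      · rw [c.total_succ (k + 1), c.compQ_succ (k + 1), effForm_compForm _ _ _ _ hT hstep, hinv]
        rfl
      · rw [c.total_succ (k + 1), c.compQ_succ (k + 1), minOp_compForm _ _ _ _ hT hstep, hinv, hmin]
        rfl
      · rw [c.total_succ (k + 1), c.compQ_succ (k + 1), minOpL_compForm _ _ _ _ hT hstep, hinv, hminL]
        rfl

/-- TELESCOPIC SUM OF FLUCTUATION COVARIANCES along the chain: under the same hypotheses,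
`flucCov (total (k+1)) (compQ (k+1)) = Σ_{j ≤ k} sminOp j · flucCov (sstep j) (Q j) · sminOpL j` — the total fluctuation
covariance is the sum over steps of the one-step fluctuation covariances transported to level `0` by the composed
minimisers (the finite-dimensional shape of the telescopic / "random-walk" decompositions of propagators in multi-scale
cluster expansions; orientation only, no equation of the series is transcribed). [folklore] -/
theorem flucCov_total (c : Chain 𝕜 Λ) :
    ∀ k : ℕ, (∀ j ≤ k, IsUnit (kkt (sstep c j) (c.Q j)).det) →
      flucCov (c.total (k + 1)) (c.compQ (k + 1)) =
        ∑ j ∈ Finset.range (k + 1), sminOp c j * flucCov (sstep c j) (c.Q j) * sminOpL c j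
  | 0, _ => by
      rw [total_one_eq_sstep, Chain.compQ_one, Finset.sum_range_one, sminOp_zero, sminOpL_zero, Matrix.one_mul,
        Matrix.mul_one]
  | k + 1, hS => by
      have hS' : ∀ j ≤ k, IsUnit (kkt (sstep c j) (c.Q j)).det := fun j hj => hS j (Nat.le_succ_of_le hj)
      obtain ⟨hT, hinv, hmin, hminL⟩ := scomp_invariant c k hS'
      have hstep : IsUnit (kkt (effForm (c.total (k + 1)) (c.compQ (k + 1)) + c.G (k + 1)) (c.Q (k + 1))).det := by
        rw [hinv]; exact hS (k + 1) le_rfl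
      rw [Finset.sum_range_succ, ← flucCov_total c k hS', c.total_succ (k + 1), c.compQ_succ (k + 1),
        flucCov_compForm _ _ _ _ hT hstep, hinv, hmin, hminL]
      rfl

end ChainSec

/-- ADDITIVITY OF `log Z` ALONG A CHAIN THROUGH BORDERED INVERSES (over `ℝ`): if no one-step bordered determinant
`det kkt (sstep j) (Q j)` (`j ≤ k`) vanishes, then `logZ (total (k+1)) (compQ (k+1)) = Σ_{j ≤ k} logZ (sstep j) (Q j)` —
the finite-dimensional shape of `Σ_j log Z^{(j)}` = one k-fold integration ([Balaban1987RG1] (1.1)–(1.5)), now for step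
forms that are non-degenerate only on the constraint surface (compare `Composition.Chain.logZ_total`). [folklore] -/
theorem logZ_total_of_kkt {Λ : ℕ → Type*} [∀ j, Fintype (Λ j)] [∀ j, DecidableEq (Λ j)] (c : Chain ℝ Λ) :
    ∀ k : ℕ, (∀ j ≤ k, (kkt (sstep c j) (c.Q j)).det ≠ 0) →
      logZ (c.total (k + 1)) (c.compQ (k + 1)) = ∑ j ∈ Finset.range (k + 1), logZ (sstep c j) (c.Q j)
  | 0, _ => by
      rw [total_one_eq_sstep, Chain.compQ_one, Finset.sum_range_one]
  | k + 1, hS => by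
      have hS' : ∀ j ≤ k, (kkt (sstep c j) (c.Q j)).det ≠ 0 := fun j hj => hS j (Nat.le_succ_of_le hj)
      have hSu : ∀ j ≤ k, IsUnit (kkt (sstep c j) (c.Q j)).det := fun j hj => isUnit_iff_ne_zero.mpr (hS' j hj)
      obtain ⟨hT, hinv, -, -⟩ := scomp_invariant c k hSu
      have hstep : (kkt (effForm (c.total (k + 1)) (c.compQ (k + 1)) + c.G (k + 1)) (c.Q (k + 1))).det ≠ 0 := by
        rw [hinv]; exact hS (k + 1) le_rfl
      rw [Finset.sum_range_succ, ← logZ_total_of_kkt c k hS', c.total_succ (k + 1), c.compQ_succ (k + 1),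
        logZ_compForm_of_kkt _ _ _ _ hT.ne_zero hstep, hinv]
      rfl

/-! ## §8. Over `ℝ`, in a kernel basis: the three blocks ARE `LogDetHessian`'s `cov`, `minimiser`, `schur` -/

section KernelBasis

variable {κ ν τ : Type*} [Fintype κ] [Fintype ν] [Fintype τ] [DecidableEq κ] [DecidableEq ν] [DecidableEq τ]

/-- DICTIONARY TO THE KERNEL-BASIS FORMULAS (`LogDetHessian.kkt_inv_eq_blockInv`, consumed by name): for `QC = 0` with
`CᵀC`, `QQᵀ`, `CᵀΔC` nonsingular and `κ ≃ ν ⊕ τ` (so `Δ` need only be non-degenerate on `ker Q = range C`),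
`flucCov Δ Q = 𝒢 = C(CᵀΔC)⁻¹Cᵀ`, `minOp Δ Q = ℋ`, `minOpL Δ Q = ℋ♭`, `effForm Δ Q = 𝒮`.  Hence everything in §§2–7
(composition of `𝒮`, `ℋ`, telescoping of `𝒢`, additivity of `log Z`) applies to those objects verbatim. [folklore] -/
theorem blocks_eq_kernelBasis (e : κ ≃ ν ⊕ τ) (Δ : Matrix κ κ ℝ) (Q : Matrix τ κ ℝ) (C : Matrix κ ν ℝ)
    (hQC : Q * C = 0) (hA : IsUnit (Cᵀ * C).det) (hM : IsUnit (Q * Qᵀ).det) (hΓ : IsUnit (Cᵀ * Δ * C).det) :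
    flucCov Δ Q = LogDetHessian.cov Δ C ∧ minOp Δ Q = LogDetHessian.minimiser Δ Q C ∧
      minOpL Δ Q = LogDetHessian.cominimiser Δ Q C ∧ effForm Δ Q = LogDetHessian.schur Δ Q C := by
  unfold flucCov minOp minOpL effForm
  rw [kkt_eq_fromBlocks, LogDetHessian.kkt_inv_eq_blockInv e Δ Q C hQC hA hM hΓ, LogDetHessian.blockInv,
    toBlocks_fromBlocks₁₁, toBlocks_fromBlocks₁₂, toBlocks_fromBlocks₂₁, toBlocks_fromBlocks₂₂, neg_neg]
  exact ⟨rfl, rfl, rfl, rfl⟩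

/-- In particular the effective form is `LogDetHessian.schur`: `effForm Δ Q = (QQᵀ)⁻¹Q(Δ − Δ𝒢Δ)Q⁺`. [folklore] -/
theorem effForm_eq_schur (e : κ ≃ ν ⊕ τ) (Δ : Matrix κ κ ℝ) (Q : Matrix τ κ ℝ) (C : Matrix κ ν ℝ)
    (hQC : Q * C = 0) (hA : IsUnit (Cᵀ * C).det) (hM : IsUnit (Q * Qᵀ).det) (hΓ : IsUnit (Cᵀ * Δ * C).det) :
    effForm Δ Q = LogDetHessian.schur Δ Q C :=
  (blocks_eq_kernelBasis e Δ Q C hQC hA hM hΓ).2.2.2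

/-- The kernel-basis hypotheses imply the single bordered hypothesis of this file (`kkt Δ Q` has the explicit two-sided
inverse `blockInv`). [folklore] -/
theorem isUnit_kkt_det_of_kernelBasis (e : κ ≃ ν ⊕ τ) (Δ : Matrix κ κ ℝ) (Q : Matrix τ κ ℝ) (C : Matrix κ ν ℝ)
    (hQC : Q * C = 0) (hA : IsUnit (Cᵀ * C).det) (hM : IsUnit (Q * Qᵀ).det) (hΓ : IsUnit (Cᵀ * Δ * C).det) :
    IsUnit (kkt Δ Q).det := by
  rw [kkt_eq_fromBlocks]
  exact Matrix.isUnit_det_of_right_inverse (LogDetHessian.kkt_mul_blockInv e Δ Q C hQC hA hM hΓ)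

end KernelBasis

end Literature.MathematicalPhysics.QuantumFieldTheory.Balaban1983to89.Beta.CompositionSingular
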